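import Mathlib
import Literature.Probability.Percolation.Percolation
import Literature.Probability.Percolation.DiagonalColumnPatterns
import Literature.Probability.Percolation.DiagonalStripTransferInhomogeneous
import Literature.Probability.Percolation.DiagonalStripTLAction
import Literature.Probability.Percolation.DiagonalStripTransferInterlacingTwoRow
import Literature.Probability.Percolation.DiagonalStripTransferReflection
import Literature.Probability.Percolation.DiagonalStripLumping
import Literature.Probability.LatticeModels.TemperleyLiebBaxterization
import HarnessLib

/-!
# `t(w; z⃗)` maps solutions of the boundary qKZ exchange equations to solutions

Topic `Literature/Probability/Percolation`. Ikhlef–Ponsaing (J. Stat. Phys. 149 (2012),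
arXiv:1202.5476) §3.4: the interlacing relations of Lemma 3.2 "yield the q-deformed
Knizhnik–Zamolodchikov equation for the ground state eigenvector",
`Ř_i(z_i/z_{i+1}) Ψ(z⃗) = Ψ(s_i z⃗)`, `Ψ(1/z_1, …) = Ψ`, `Ψ(…, 1/z_L) = Ψ`. The algebraic content
used downstream is: if a family `ψ_z` solves the `i`-th exchange equation (in the kernel convention of
`DiagonalStripTransferInterlacingTwoRow.lean`, `e_{2j+1} = join`, `e_{2b} = iso`, `≡` up to lumping)
then so does `Φ_z := t(w; z⃗) ψ_z` (with `Φ_{s_i z} = t(w; s_i z⃗) ψ_{s_i z}`):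
**`ipTransferMatrixW_exchange_propagate_odd/_even`** (from Lemma 3.2 via the abstract
`exchange_propagate`), and `t` preserves the component sum (`sum_ipTransferMatrixW_apply`, rows of
`t` sum to `1`). With the reflections of `DiagonalStripTransferReflection.lean` this is the statement
"`t(w;·)Ψ` solves the same boundary qKZ system as `Ψ`", the first half of the identification of the
ground state with the qKZ solution (the other half is a uniqueness theorem for that system, not here).

## References

* Y. Ikhlef, A. K. Ponsaing, J. Stat. Phys. 149 (2012) 10–36, arXiv:1202.5476, §3.4.
  [IkhlefPonsaing2012]
-/

namespace Literature.Probability.Percolation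

open Relation Literature.Probability.LatticeModels Literature.Probability.LatticeModels.TemperleyLieb

variable {m : ℕ}

/-! ### Propagation of the exchange equations through an interlacing kernel -/

section Propagate

variable {K : Type*} [Field K] {S : Type*} [Fintype S]

/-- **The total mass is preserved by a stochastic kernel**: `Σ_{Q''} (tψ)(Q'') = Σ_Q ψ(Q)` when the
rows of `t` sum to `1`. [folklore] -/
theorem sum_kernel_apply {t : S → S → K} (ht : ∀ Q, ∑ Q'', t Q Q'' = 1) (ψ : S → K) :
    ∑ Q'', ∑ Q, t Q Q'' * ψ Q = ∑ Q, ψ Q := by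
  rw [Finset.sum_comm]
  refine Finset.sum_congr rfl fun Q _ => ?_
  rw [← Finset.sum_mul, ht, one_mul]

variable [DecidableEq S]

/-- **An interlacing kernel maps solutions of the exchange equation to solutions.** Abstract form:
if `t, t'` interlace (`α t(Q→Q'') - β Σ_{ℓ(g Q') = Q''} t(Q→Q') = α t'(Q→Q'') - β t'(gQ→Q'')` for the
inputs `Q` in the support of `ψ`), `t'` does not distinguish `P` from `ℓ P` as an input, and
`α ψ(Q) - β Σ_{ℓ(g Q₀) = Q} ψ(Q₀) = γ ψ'(Q)` for all `Q`, then `Φ = tψ`, `Φ' = t'ψ'` satisfy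
`α Φ(Q'') - β Σ_{ℓ(g Q') = Q''} Φ(Q') = γ Φ'(Q'')`. [cite: IkhlefPonsaing2012, §3.4] -/
theorem exchange_propagate {t t' : S → S → K} {g ℓ : S → S} {α β γ : K} {ψ ψ' : S → K} {V : S → Prop}
    (h32 : ∀ Q, V Q → ∀ Q'', α * t Q Q'' - β * ∑ Q' ∈ Finset.univ.filter (fun Q' => ℓ (g Q') = Q''), t Q Q' =
      α * t' Q Q'' - β * t' (g Q) Q'')
    (hψ : ∀ Q, α * ψ Q - β * ∑ Q₀ ∈ Finset.univ.filter (fun Q₀ => ℓ (g Q₀) = Q), ψ Q₀ = γ * ψ' Q)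
    (hV : ∀ Q, ψ Q ≠ 0 → V Q) (hℓ : ∀ P Q'', t' (ℓ P) Q'' = t' P Q'') (Q'' : S) :
    α * (∑ Q, t Q Q'' * ψ Q) -
        β * ∑ Q' ∈ Finset.univ.filter (fun Q' => ℓ (g Q') = Q''), ∑ Q, t Q Q' * ψ Q =
      γ * ∑ Q, t' Q Q'' * ψ' Q := by
  -- left: the interlacing kernel identity inside the sum over `Q`
  have hL : α * (∑ Q, t Q Q'' * ψ Q) -
      β * ∑ Q' ∈ Finset.univ.filter (fun Q' => ℓ (g Q') = Q''), ∑ Q, t Q Q' * ψ Q =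
      ∑ Q, (α * t' Q Q'' - β * t' (g Q) Q'') * ψ Q := by
    rw [Finset.sum_comm, Finset.mul_sum, Finset.mul_sum, ← Finset.sum_sub_distrib]
    refine Finset.sum_congr rfl fun Q _ => ?_
    by_cases hQ : ψ Q = 0
    · simp [hQ]
    · rw [← h32 Q (hV Q hQ) Q'', ← Finset.sum_mul]; ring
  -- right: expand `γ ψ'` by the exchange equation for `ψ`
  have h1 : ∀ Q, γ * (t' Q Q'' * ψ' Q) = α * (t' Q Q'' * ψ Q) -
      β * (t' Q Q'' * ∑ Q₀ ∈ Finset.univ.filter (fun Q₀ => ℓ (g Q₀) = Q), ψ Q₀) := fun Q => by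
    have := hψ Q
    linear_combination (-t' Q Q'') * this
  -- … and regroup the double sum along the fibres of `ℓ ∘ g`
  have h2 : ∑ Q, t' Q Q'' * ∑ Q₀ ∈ Finset.univ.filter (fun Q₀ => ℓ (g Q₀) = Q), ψ Q₀ =
      ∑ Q₀, t' (g Q₀) Q'' * ψ Q₀ := by
    rw [← Finset.sum_fiberwise Finset.univ (fun Q₀ => ℓ (g Q₀)) (fun Q₀ => t' (g Q₀) Q'' * ψ Q₀)]
    refine Finset.sum_congr rfl fun Q _ => ?_
    rw [Finset.mul_sum]
    refine Finset.sum_congr rfl fun Q₀ hQ₀ => ?_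
    rw [← hℓ (g Q₀) Q'', (Finset.mem_filter.1 hQ₀).2]
  have hR : γ * ∑ Q, t' Q Q'' * ψ' Q = ∑ Q, (α * t' Q Q'' - β * t' (g Q) Q'') * ψ Q := by
    rw [Finset.mul_sum]
    simp_rw [h1]
    rw [Finset.sum_sub_distrib, ← Finset.mul_sum, ← Finset.mul_sum, h2, Finset.mul_sum, Finset.mul_sum,
      ← Finset.sum_sub_distrib]
    refine Finset.sum_congr rfl fun Q _ => ?_
    ring
  rw [hL, hR]

end Propagate

/-! ### The case of `t(w; z⃗)` -/

section TransferQKZ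

variable {K : Type*} [Field K]

/-- `t(w; z⃗)` does not distinguish an input from its lumping. [folklore] -/
theorem ipTwoLayerW_lump_input (p₀ p₁ : Sym2 (Site 2) → K) (P Q'' : ColPattern m) :
    ipTwoLayerW m p₀ p₁ (lump P) Q'' = ipTwoLayerW m p₀ p₁ P Q'' := by
  rw [ipTwoLayerW_eq_sum_sum, ipTwoLayerW_eq_sum_sum]
  refine Finset.sum_congr rfl fun U₀ _ => ?_
  congr 1
  refine Finset.sum_congr rfl fun U₁ _ => ?_
  rw [lump_colUpdate_congr 1 (lump_colUpdate_lump 0 P (edgeFn m 0 U₀))]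

/-- **`t(w; z⃗)` maps solutions of the `i`-th exchange equation (odd `i = 2j+1`, `e_i = join`) at `z⃗`
to solutions**: if `ψ_z` is supported on valid even patterns and
`[q z_{i+1}/z_i] ψ_z(Q) - [z_i/z_{i+1}] Σ_{lump (e_i Q₀) = Q} ψ_z(Q₀) = γ ψ_{s_i z}(Q)` for all `Q`, then the
same holds for `Φ_z = t(w; z⃗) ψ_z`, `Φ_{s_i z} = t(w; s_i z⃗) ψ_{s_i z}` (generic parameters).
[cite: IkhlefPonsaing2012, §3.4] -/
theorem ipTransferMatrixW_exchange_propagate_odd {q w : K} (hq : q ^ 2 + q + 1 = 0) (hw : w ≠ 0) (z : ℕ → K)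
    (j j1 : Fin (m + 1)) (hj1 : (j1 : ℕ) = j + 1)
    (hz : z (2 * j + 1) ≠ 0) (hz' : z (2 * j + 2) ≠ 0)
    (h1 : qbr (q * w / z (2 * j + 1)) ≠ 0) (h2 : qbr (q * w / z (2 * j + 2)) ≠ 0)
    (h3 : qbr (q * w * z (2 * j + 1)) ≠ 0) (h4 : qbr (q * w * z (2 * j + 2)) ≠ 0)
    {ψ ψ' : ColPattern m → K} {γ : K} (hV : ∀ Q, ψ Q ≠ 0 → IsValid 0 Q)
    (hψ : ∀ Q, qbr (q * z (2 * j + 2) / z (2 * j + 1)) * ψ Q -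
      qbr (z (2 * j + 1) / z (2 * j + 2)) * ∑ Q₀ ∈ Finset.univ.filter (fun Q₀ => lump (cpJoin j j1 Q₀) = Q), ψ Q₀ =
      γ * ψ' Q) (Q'' : ColPattern m) :
    qbr (q * z (2 * j + 2) / z (2 * j + 1)) * (∑ Q, ipTransferMatrixW m q w z Q Q'' * ψ Q) -
        qbr (z (2 * j + 1) / z (2 * j + 2)) *
          ∑ Q' ∈ Finset.univ.filter (fun Q' => lump (cpJoin j j1 Q') = Q''), ∑ Q, ipTransferMatrixW m q w z Q Q' * ψ Q =
      γ * ∑ Q, ipTransferMatrixW m q w (zswap z (2 * j + 1)) Q Q'' * ψ' Q :=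
  exchange_propagate (V := IsValid 0)
    (fun Q hQ Q'' => ipTransferMatrixW_interlace_odd hq hw z j j1 hj1 hz hz' h1 h2 h3 h4 hQ Q'')
    hψ hV (fun P Q'' => by rw [ipTransferMatrixW_eq, ipTransferMatrixW_eq, ipTwoLayerW_lump_input]) Q''

/-- The same at an even level `i = 2b` (`e_i = iso_b`). [cite: IkhlefPonsaing2012, §3.4] -/
theorem ipTransferMatrixW_exchange_propagate_even {q w : K} (hq : q ^ 2 + q + 1 = 0) (hw : w ≠ 0) (z : ℕ → K)
    (b0 b : Fin (m + 1)) (hb0 : (b : ℕ) = b0 + 1)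
    (hz : z (2 * b) ≠ 0) (hz' : z (2 * b + 1) ≠ 0)
    (h1 : qbr (q * w / z (2 * b)) ≠ 0) (h2 : qbr (q * w / z (2 * b + 1)) ≠ 0)
    (h3 : qbr (q * w * z (2 * b)) ≠ 0) (h4 : qbr (q * w * z (2 * b + 1)) ≠ 0)
    {ψ ψ' : ColPattern m → K} {γ : K} (hV : ∀ Q, ψ Q ≠ 0 → IsValid 0 Q)
    (hψ : ∀ Q, qbr (q * z (2 * b + 1) / z (2 * b)) * ψ Q -
      qbr (z (2 * b) / z (2 * b + 1)) * ∑ Q₀ ∈ Finset.univ.filter (fun Q₀ => lump (cpIsolate b Q₀) = Q), ψ Q₀ =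
      γ * ψ' Q) (Q'' : ColPattern m) :
    qbr (q * z (2 * b + 1) / z (2 * b)) * (∑ Q, ipTransferMatrixW m q w z Q Q'' * ψ Q) -
        qbr (z (2 * b) / z (2 * b + 1)) *
          ∑ Q' ∈ Finset.univ.filter (fun Q' => lump (cpIsolate b Q') = Q''), ∑ Q, ipTransferMatrixW m q w z Q Q' * ψ Q =
      γ * ∑ Q, ipTransferMatrixW m q w (zswap z (2 * b)) Q Q'' * ψ' Q :=
  exchange_propagate (V := IsValid 0)
    (fun Q hQ Q'' => ipTransferMatrixW_interlace_even hq hw z b0 b hb0 hz hz' h1 h2 h3 h4 hQ Q'')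
    hψ hV (fun P Q'' => by rw [ipTransferMatrixW_eq, ipTransferMatrixW_eq, ipTwoLayerW_lump_input]) Q''

/-- **`t(w; z⃗)` preserves the component sum**: `Σ_{Q''} (tψ)(Q'') = Σ_Q ψ(Q)`. [cite: IkhlefPonsaing2012, §3.1] -/
theorem sum_ipTransferMatrixW_apply (q w : K) (z : ℕ → K) (ψ : ColPattern m → K) :
    ∑ Q'', ∑ Q, ipTransferMatrixW m q w z Q Q'' * ψ Q = ∑ Q, ψ Q :=
  sum_kernel_apply (fun Q => by simp_rw [ipTransferMatrixW_eq]; exact sum_ipTwoLayerW _ _ Q) ψ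

end TransferQKZ

end Literature.Probability.Percolation
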